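import Summits.AtomisticToContinuum.BoseEinsteinCondensation.Theses.BECInfraredBound

/-!
# Birth skeleton (BC3) for crux `BecIrWindow` — stmt-AtomisticToContinuum-8911
(route `BECInfraredBound`, rank 2; sub-problem `BoseEinsteinCondensation`)

Planner `planner-skel-stmt-AtomisticToContinuum-8911-0`, 2026-08-17 (skeleton-register, re-audit bin
REPAIRABLE). Published as `Cruxes/BecIrWindow/Lines/birth.lean`; line card `Lines/birth.md`; probe
audit `BC3-probes.md`.

The crux is the T = 0 INFRARED BOUND, WINDOW FORM: for every repulsive finite-range `v` with
`a(v) > 0`, every `ε ∈ (0,1/4)`, `K > 0`, there are `ρ₀, C` such that every `δ`-near-minimiser `Ψ`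
of the Dirichlet `N`-body energy in the box of side `L = (N/ρ)^{1/3}` (`ρ < ρ₀`, `N` large, some
`δ > 0`) has `⟨φ'_k, γ_Ψ φ'_k⟩ ≤ C(1 + √ρ L/‖k‖)` for every SHARP inner-box plane wave
`φ'_k = L'^{-3/2} e^{2πik·x/L'} 1_{Λ'}`, `Λ' = (εL, L-εL)³`, `L' = (1-2ε)L`, `0 < ‖k‖ ≤ K√ρ L`.

## The line: BASIS-FREE FORM BOUND + SHARP-WINDOW HARMONIC ANALYSIS

The per-mode bound on the particular sharp modes `φ'_k` is split into WHAT THE PHYSICS SHOULD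
DELIVER and WHAT THE MODE CONTRIBUTES:

* `stub_formInfraredBound` (A, the open core, hardest): the T = 0 infrared bound as an OPERATOR
  INEQUALITY on the healed bulk — for every smooth `f` vanishing off `Λ'` with `∫ f = 0`,
  `⟨f, γ_Ψ f⟩ ≤ C(‖f‖₂² + √ρ ‖f‖²_{Ḣ^{-1/2}})`, `‖f‖²_{Ḣ^{-1/2}} = ∫ |𝓕f(ξ)|²/|ξ| dξ`; i.e.
  `γ_Ψ ≤ C(1 + √ρ |∇|⁻¹)` on mean-zero bulk modes: the continuum, basis-free transcription of the
  DLS/KLS bound `n_p ≤ C(1 + √(ρa)/|p|)` (on a torus `⟨f, γ f⟩ = Σ_p n_p |f̂(p)|²`). Mean zero is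
  what kills the condensate EXACTLY (the crux's whole-period device, generalised); smooth test
  functions are what commutator / linear-response (second-order energy) methods need — for the sharp
  mode the double commutator `⟨[a*(φ'), [H, a(φ')]]⟩ ∋ ‖∇φ'_k‖₂² = +∞` (the sharp-window
  divergence refuters g24-0/g41-8 recorded on items 0733/8823).
* `stub_formBoundExtension` (B, functional analysis, provable now): such a form bound passes from
  smooth to square-integrable mean-zero modes vanishing off the cube, for EVERY fixed `N`-body
  function `Ψ ∈ L²` and all constants (`√occupation` is an `L²`-seminorm in the mode; dilate towards
  the centre, mollify; the Riesz energy does not increase). States nothing about `v`, energies or BEC.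
* `stub_windowModeRiesz` (C, harmonic analysis, provable now): the sharp mode `φ'_k` is measurable,
  lives in `Λ'`, has ZERO MEAN (whole periods, `k ≠ 0`), `‖φ'_k‖₂² ≤ 1`, and Riesz energy
  `≤ C_R L/‖k‖` — `|𝓕φ'_k|² = L'³ ∏ sinc²`, a 3-D integral `∫ ∏ sinc²(u_j)/|u + πk| du = O(1/|k|)`
  whose logarithmic ray `O(log|k|/|k|²)` is the crux docstring's "sharp-window correction
  `√ρ L log‖k‖/‖k‖²`, inside the bound".

`BecIrWindow_of : A → B → C → BecIrWindow` (hypotheses spelled by the registered-name aliases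
`__Registered.stub_X`, each `rfl`-equal to its statement) is a REAL PROOF: `ρ₀, C` from A, `C_R`
from C, constant `C · max 1 C_R`; for a near-minimiser `Ψ` apply B to `Ψ.ψ` (measurable by `C¹`,
`‖Ψ‖₂ = 1`) with the cube `(εL, L-εL)³`, `c₁ = C`, `c₂ = √ρ`, the smooth bound from A, and the mode
facts from C; then `occ ≤ C(1 + √ρ · C_R L/‖k‖) ≤ (C max(1,C_R))(1 + √ρ L/‖k‖)` in `ℝ≥0∞`
(`assembly_arith`). The window restriction `‖k‖ ≤ K√ρL` is not used (the line gives all `k ≠ 0`).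
`lean check --json`: rc 0, errors [], sorries 3 = the three `stub_*` (zero elsewhere);
`#print axioms BecIrWindow_of` = [propext, Classical.choice, Quot.sound].

Why this is not shredding / costume: no stub is the crux — A bounds a quadratic form on smooth
mean-zero test functions by an `Ḣ^{-1/2}` energy (no plane wave, no `1/‖k‖`, no window), and the
crux follows from it only through the genuine harmonic analysis of C and the density argument of
B; B and C mention neither `v` nor energies nor near-minimisers. None mentions
`maxOccupation`/`condensateNumber`/`HasGroundStateBEC` (probes `stub → BoseEinsteinCondensation`
fail). BC3 probes (files `bc/<Stub>_probe.lean`, stub statement def only + 10 examples each: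
`first | exact? | simpa [S] | (unfold S; simpa) | aesop` and the four tactics singly, against the crux
and against `_root_.BoseEinsteinCondensation`): 30/30 FAIL — see `BC3-probes.md`.
Disproof used: none on file (`ledger crux ls stmt-AtomisticToContinuum-8911`: no `Disproof.lean`, no
prior lines, 2026-08-17). Negatives index (20 entries): no entry is an instance of a stub (the two BEC
negatives, BerryStiffPhaseLRO 14490 and SwapJensen 3980, concern other objects).
Degenerate cases: `L = 0`/`N = 0` — `φ'_k = 0`, `occupation 0 _ _ = 0`, C holds with `ofReal 0`;
`k = 0` excluded (there `∫ φ'_0 ≠ 0` and the crux's `‖k‖⁻¹` is junk); `v` a.e. zero excluded in A as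
in the crux (the free Dirichlet gas violates every infrared bound on `Λ'`: its condensate
`∏ sin(πx_j/L)` is not constant on `Λ'`, so mean-zero modes see `O(N)` occupation).

Next split of A (recorded for crux-ideate, not filed): T = 0 Kennedy–Lieb–Shastry in canonical
variational form — (A1) TRANSFER SUSCEPTIBILITY bound (the Gaussian-domination substitute: a
second-order ENERGY LOWER BOUND `E₀(H_N - λ Σ_i t_i) ≥ E₀ - λ m - C λ² N ‖f‖₂²/ε_f` for the rank-two
one-body transfer `t = |g⟩⟨f| + |f⟩⟨g|`, `g` a smooth bulk bump; OPEN, LHY-technology-shaped),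
(A2) the double-commutator / curvature bound for near-minimisers (finite for smooth `f, g`),
(A3) the T = 0 Falk–Bruch Cauchy–Schwarz `Σ_n|⟨n|T|0⟩|² ≤ ½√(χ_T D_T)` for near-minimisers, with the
floor trick `a*(f)(N_g + 1)a(f) ≥ a*(f)a(f)` (no a-priori condensation in `g` needed) and BOTH
quadratures (the phase quadrature saturates Gaussian domination: `χ₋ = (2N/ε)(n₀/ρ_s) < 2N/ε`
because `ρ_s = ρ ≥ n₀` at `T = 0`).
-/

noncomputable section

namespace Summit.AtomisticToContinuum.BoseEinsteinCondensation.Cruxes.BecIrWindow.Birth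

open MeasureTheory Filter
open scoped ENNReal NNReal ComplexConjugate BigOperators FourierTransform
open Literature.MathematicalPhysics.QuantumManyBody.BoseGas
open Summit.AtomisticToContinuum.BoseEinsteinCondensation.Theses.BECInfraredBound

/-! ## Local vocabulary (definitions only; each unfolds to the crux's verbatim sub-expressions) -/

/-- The open coordinate cube `(a, b)³ ⊂ ℝ³` (empty if `b ≤ a`). With `a = εL`, `b = L - εL` this is
the crux's inner box `Λ'_ε = (εL, L-εL)³`, character for character. [folklore] -/
def cube (a b : ℝ) : Set Space :=
  {x : EuclideanSpace ℝ (Fin 3) | ∀ j, x j ∈ Set.Ioo a b}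

/-- The crux's inner-box plane wave `φ'_k = L'^{-3/2} e^{2πi k·x/L'} 1_{Λ'}`, `L' = (1-2ε)L`,
`Λ' = (εL, L-εL)³`, as a function of `ε, L, k` (the crux has `L = sideLength ρ N`; the body is its
verbatim mode expression). [cite: LSSY2005, Ch. 11 (inner-box modes); route BECInfraredBound] -/
def windowMode (ε L : ℝ) (k : Fin 3 → ℤ) : Space → ℂ :=
  {x : EuclideanSpace ℝ (Fin 3) | ∀ j, x j ∈ Set.Ioo (ε * L) (L - ε * L)}.indicator fun x =>
    ((Real.sqrt (((1 - 2 * ε) * L) ^ 3))⁻¹ : ℂ) *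
      Complex.exp (Complex.I * ↑(2 * Real.pi / ((1 - 2 * ε) * L) * ∑ j, (k j : ℝ) * x j))

/-- The `Ḣ^{-1/2}(ℝ³)` ("Riesz", `|∇|⁻¹`-form) energy of a mode `f : ℝ³ → ℂ`, through the Fourier
transform `𝓕 f (ξ) = ∫ e^{-2πi⟨x,ξ⟩} f(x) dx` (Mathlib convention): `∫ |𝓕 f(ξ)|² / |ξ| dξ ∈ [0, ∞]`
(`= c₃ ∫∫ conj f(x) f(y) / |x-y|² dx dy` for nice `f`). For a function localised in frequency near
`|ξ| = |k|/L'` it is `≈ ‖f‖₂² · L'/|k|`: the infrared weight `1/|p|` of the T = 0 infrared bound,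
written basis-free. [folklore] -/
def rieszEnergy (f : Space → ℂ) : ℝ≥0∞ :=
  ∫⁻ ξ : Space, ((‖𝓕 f ξ‖₊ : ℝ≥0∞) ^ 2) / (‖ξ‖₊ : ℝ≥0∞)

/-! ## Stub statements -/

/-- **Stub A — T = 0 INFRARED BOUND IN QUADRATIC-FORM (`|∇|⁻¹`) SHAPE, smooth test functions
(the physics; OPEN — the bet of the route, sharpened).** For every repulsive finite-range `v` that is
not a.e. zero on `(0,∞)` and every `ε ∈ (0,1/4)` there are `ρ₀, C > 0` such that for `0 < ρ < ρ₀`,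
all large `N`, some `δ > 0` and every `δ`-near-minimiser `Ψ` of the Dirichlet energy in the box of
side `L = (N/ρ)^{1/3}`: for every SMOOTH mode `f : ℝ³ → ℂ` vanishing off the inner box
`Λ' = (εL, L-εL)³` with ZERO MEAN `∫ f = 0`,
`⟨f, γ_Ψ f⟩ = occupation N f Ψ ≤ C · (‖f‖₂² + √ρ · ∫ |𝓕f(ξ)|²/|ξ| dξ)`,
i.e. the bulk one-particle density matrix obeys the operator infrared bound
`γ_Ψ ≤ C (1 + √ρ |∇|⁻¹)` on mean-zero functions of the healed bulk — the continuum, basis-free form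
of the Dyson–Lieb–Simon / Kennedy–Lieb–Shastry T = 0 bound `n_p ≤ C(1 + √(ρa)/|p|)` (`√a` in `C`).
Why it might fail: it is the open continuum T = 0 infrared bound (no reflection positivity); the
mean-zero condition must kill the condensate exactly while wall-healing corrections to the
condensate wave function inside `Λ'` (`e^{-εL/ξ}`, or power-law beyond mean field) must stay
`o(‖f‖₂²/N)`; near-minimisers are handled by `δ` chosen after `N` (gap at fixed `N, L`).
[cite: DysonLiebSimon1978; KLS1988PRL; LSSY2005, Ch. 11; PitaevskiiStringari1991] -/
def FormInfraredBound : Prop :=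
  ∀ v : ℝ → ℝ≥0∞, IsRepulsiveFiniteRange v →
    ¬ (∀ᵐ r ∂(MeasureTheory.volume.restrict (Set.Ioi (0 : ℝ))), v r = 0) →
    ∀ ε : ℝ, 0 < ε → ε < 1 / 4 →
      ∃ ρ₀ : ℝ, 0 < ρ₀ ∧ ∃ C : ℝ, 0 < C ∧ ∀ ρ : ℝ, 0 < ρ → ρ < ρ₀ →
        ∀ᶠ N : ℕ in Filter.atTop, ∃ δ : ℝ≥0∞, 0 < δ ∧
          ∀ Ψ : TrialState N (sideLength ρ N),
            energy v Ψ ≤ groundStateEnergy v N (sideLength ρ N) + δ →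
            ∀ f : Space → ℂ, ContDiff ℝ ((⊤ : ℕ∞) : WithTop ℕ∞) f →
              (∀ x ∉ cube (ε * sideLength ρ N) (sideLength ρ N - ε * sideLength ρ N), f x = 0) →
              ∫ x, f x = 0 →
              occupation N f Ψ.ψ ≤
                ENNReal.ofReal C *
                  ((∫⁻ x, (‖f x‖₊ : ℝ≥0∞) ^ 2) + ENNReal.ofReal (Real.sqrt ρ) * rieszEnergy f)

/-- **Stub B — EXTENSION OF A FORM BOUND FROM SMOOTH TO SQUARE-INTEGRABLE MODES (functional
analysis; provable now, size M/L).** Fix `N`, a measurable square-integrable `Ψ : (ℝ³)^N → ℂ`, a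
coordinate cube `Q = (a,b)³` and constants `c₁, c₂ ≥ 0`. If
`occupation N f Ψ ≤ c₁ (‖f‖₂² + c₂ ∫|𝓕f|²/|ξ|)` holds for every smooth `f` vanishing off `Q` with
`∫ f = 0`, then it holds for every measurable `f ∈ L²` vanishing off `Q` with `∫ f = 0`.
Proof sketch: `√occupation` is an `L²`-seminorm in the mode dominated by `√N ‖Ψ‖₂ ‖f‖₂`
(Cauchy–Schwarz in the first variable), so the left side is `L²`-continuous in `f`; approximate
`f` by `(f ∘ δ_s) * η_t` (dilate towards the centre of `Q` by `s < 1`, then mollify): smooth,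
supported in `Q`, mean zero, `→ f` in `L²`, and with Riesz energy `≤ s⁴ · (Riesz energy of f)`
(`|𝓕η_t| ≤ 1`, scaling), so the right side does not increase in the limit. Empty cube (`b ≤ a`):
`f = 0`, trivial. Why it might fail: only formally (junk values of non-integrable Bochner
integrals inside `occupation` on a null set of spectator configurations). [folklore] -/
def FormBoundExtension : Prop :=
  ∀ (N : ℕ) (Ψ : Config N → ℂ), Measurable Ψ → (∫⁻ X, (‖Ψ X‖₊ : ℝ≥0∞) ^ 2) ≠ ⊤ →
    ∀ (a b c₁ c₂ : ℝ), 0 ≤ c₁ → 0 ≤ c₂ →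
      (∀ f : Space → ℂ, ContDiff ℝ ((⊤ : ℕ∞) : WithTop ℕ∞) f → (∀ x ∉ cube a b, f x = 0) →
          ∫ x, f x = 0 →
          occupation N f Ψ ≤
            ENNReal.ofReal c₁ * ((∫⁻ x, (‖f x‖₊ : ℝ≥0∞) ^ 2) + ENNReal.ofReal c₂ * rieszEnergy f)) →
      ∀ f : Space → ℂ, Measurable f → (∀ x ∉ cube a b, f x = 0) → ∫ x, f x = 0 →
        (∫⁻ x, (‖f x‖₊ : ℝ≥0∞) ^ 2) ≠ ⊤ →
        occupation N f Ψ ≤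
          ENNReal.ofReal c₁ * ((∫⁻ x, (‖f x‖₊ : ℝ≥0∞) ^ 2) + ENNReal.ofReal c₂ * rieszEnergy f)

/-- **Stub C — THE SHARP INNER-BOX PLANE WAVE AS A TEST FUNCTION: whole periods kill the mean, and
its Riesz energy is `O(L/‖k‖)` (harmonic analysis; provable now, size M/L).** For every
`ε ∈ (0,1/4)` there is `C > 0` such that for every `L ≥ 0` and every `k ∈ ℤ³ ∖ {0}` the mode
`φ'_k = windowMode ε L k` is measurable, vanishes off `Λ' = (εL, L-εL)³`, has `∫ φ'_k = 0`
(each side of `Λ'` is exactly `L' = (1-2ε)L`, i.e. `k_j` whole periods, and some `k_j ≠ 0`),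
`‖φ'_k‖₂² ≤ 1` (`= 1` for `L > 0`), and `∫ |𝓕φ'_k(ξ)|²/|ξ| dξ ≤ C · L/‖k‖` (sup norm on `ℤ³`).
The last estimate: `|𝓕φ'_k(ξ)|² = L'³ ∏_j sinc²(π(ξ_j L' - k_j))`, so after `u = π(ξL' - k)` the
energy is `(L'/π) ∫_{ℝ³} ∏_j sinc²(u_j) / |u + πk| du = O(L'/|k|) + O(L' log|k| / |k|²)` (the
logarithm from the ray `u ≈ -πk + t e_k`; this is the crux's "sharp-window correction
`√ρ L log‖k‖/‖k‖²`", inside the bound). `L = 0`: empty box, `φ'_k = 0`, all claims trivial.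
Why it might fail: only formally (Fubini on `EuclideanSpace ℝ (Fin 3)`, the `sinc` algebra, the
3-D integral with its logarithmic ray). [cite: LSSY2005, Ch. 11 (11.26)–(11.27); folklore] -/
def WindowModeRiesz : Prop :=
  ∀ ε : ℝ, 0 < ε → ε < 1 / 4 → ∃ C : ℝ, 0 < C ∧ ∀ L : ℝ, 0 ≤ L → ∀ k : Fin 3 → ℤ, k ≠ 0 →
    Measurable (windowMode ε L k) ∧
    (∀ x ∉ cube (ε * L) (L - ε * L), windowMode ε L k x = 0) ∧
    ∫ x, windowMode ε L k x = 0 ∧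
    (∫⁻ x, (‖windowMode ε L k x‖₊ : ℝ≥0∞) ^ 2) ≤ 1 ∧
    rieszEnergy (windowMode ε L k) ≤ ENNReal.ofReal (C * L / ‖(fun j => (k j : ℝ))‖)

/-! ## Registered stubs -/

/-- stub A: the quadratic-form T = 0 infrared bound (hardest stub; the open core of the crux). -/
theorem stub_formInfraredBound : FormInfraredBound := by
  sorry

/-- stub B: smooth-to-`L²` extension of the form bound (provable now). -/
theorem stub_formBoundExtension : FormBoundExtension := by
  sorry

/-- stub C: the sharp window mode is an admissible test function with Riesz energy `O(L/‖k‖)`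
(provable now). -/
theorem stub_windowModeRiesz : WindowModeRiesz := by
  sorry

/-! ## Name-keyed aliases of the stub statements — the hypotheses of `BecIrWindow_of`

The native skeleton audit (`#h21_check_skeleton`) admits a hypothesis of the skeleton theorem only if
its head constant is a registered obligation or is NAMED like a declared stub; `__Registered.stub_X`
is the statement of `stub_X` under that name (device of `Cruxes/AmplitudeLDP/Lines/birth.lean` and
`Cruxes/BlockInfraredBound/Lines/birth.lean` in this sub-problem). Each alias is `rfl`-equal to its
statement. -/
namespace __Registered

/-- Alias of `FormInfraredBound` keyed by the registered stub name. -/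
abbrev stub_formInfraredBound : Prop := FormInfraredBound
/-- Alias of `FormBoundExtension` keyed by the registered stub name. -/
abbrev stub_formBoundExtension : Prop := FormBoundExtension
/-- Alias of `WindowModeRiesz` keyed by the registered stub name. -/
abbrev stub_windowModeRiesz : Prop := WindowModeRiesz

end __Registered

/-! ## Elementary arithmetic of the assembly (sorry-free) -/

/-- `ℝ≥0∞` bookkeeping: from `occ ≤ C (A + √ρ B)`, `A ≤ 1`, `B ≤ C_R L/‖k‖` to
`occ ≤ (C · max 1 C_R)(1 + √ρ L/‖k‖)`. [folklore] -/
theorem assembly_arith {C CR r L nk : ℝ} (hC : 0 ≤ C) (hCR : 0 ≤ CR) (hr : 0 ≤ r) (hL : 0 ≤ L)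
    (hnk : 0 ≤ nk) {A B occ : ℝ≥0∞} (hA : A ≤ 1) (hB : B ≤ ENNReal.ofReal (CR * L / nk))
    (h : occ ≤ ENNReal.ofReal C * (A + ENNReal.ofReal r * B)) :
    occ ≤ ENNReal.ofReal (C * max 1 CR * (1 + r * L / nk)) := by
  have h1 : occ ≤ ENNReal.ofReal C * (1 + ENNReal.ofReal r * ENNReal.ofReal (CR * L / nk)) :=
    h.trans (by gcongr)
  refine h1.trans ?_
  have hx : 0 ≤ CR * L / nk := by positivity
  rw [← ENNReal.ofReal_mul hr, ← ENNReal.ofReal_one,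
    ← ENNReal.ofReal_add zero_le_one (mul_nonneg hr hx), ← ENNReal.ofReal_mul hC]
  apply ENNReal.ofReal_le_ofReal
  have hM1 : (1 : ℝ) ≤ max 1 CR := le_max_left _ _
  have hM2 : CR ≤ max 1 CR := le_max_right _ _
  have hy : 0 ≤ r * L / nk := by positivity
  calc C * (1 + r * (CR * L / nk)) = C * 1 + C * CR * (r * L / nk) := by ring
    _ ≤ C * max 1 CR + C * max 1 CR * (r * L / nk) :=
        add_le_add (mul_le_mul_of_nonneg_left hM1 hC)
          (mul_le_mul_of_nonneg_right (mul_le_mul_of_nonneg_left hM2 hC) hy)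
    _ = C * max 1 CR * (1 + r * L / nk) := by ring

/-! ## Composition: the crux BY NAME from the three stub statements (no `sorry` below) -/

/-- **BecIrWindow_of** — (A) the form infrared bound for smooth mean-zero bulk modes, (B) its
extension to `L²` modes, (C) the sharp window mode `φ'_k` is such a mode with `‖φ'_k‖₂² ≤ 1` and
Riesz energy `≤ C_R L/‖k‖` ⟹ the crux: `⟨φ'_k, γ_Ψ φ'_k⟩ ≤ C(1 + √ρ C_R L/‖k‖) ≤
(C max(1,C_R))(1 + √ρ L/‖k‖)` for every `k ≠ 0` (the window restriction `‖k‖ ≤ K√ρL` is not even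
needed). Hypotheses = the three stub statements under their registered names; conclusion = the route
decl `BECInfraredBound.BecIrWindow`, by name. -/
theorem BecIrWindow_of (hA : __Registered.stub_formInfraredBound)
    (hB : __Registered.stub_formBoundExtension) (hC : __Registered.stub_windowModeRiesz) :
    Summit.AtomisticToContinuum.BoseEinsteinCondensation.Theses.BECInfraredBound.BecIrWindow := by
  intro v hv hne ε hε hε4 K _hK
  obtain ⟨ρ₀, hρ₀, C, hC0, hmain⟩ := hA v hv hne ε hε hε4
  obtain ⟨CR, hCR, hR⟩ := hC ε hε hε4
  refine ⟨ρ₀, hρ₀, C * max 1 CR, mul_pos hC0 (lt_of_lt_of_le one_pos (le_max_left _ _)), ?_⟩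
  intro ρ hρ hρ₀'
  filter_upwards [hmain ρ hρ hρ₀'] with N hN
  obtain ⟨δ, hδ, hΨ⟩ := hN
  refine ⟨δ, hδ, ?_⟩
  intro Ψ hE k hk _hkK
  have hL : 0 ≤ sideLength ρ N := Real.rpow_nonneg (div_nonneg (Nat.cast_nonneg _) hρ.le) _
  obtain ⟨hmeas, hsupp, hmean, hL2, hRz⟩ := hR (sideLength ρ N) hL k hk
  have hΨ2 : (∫⁻ X, (‖Ψ.ψ X‖₊ : ℝ≥0∞) ^ 2) ≠ ⊤ := by
    rw [Ψ.norm_eq]; exact ENNReal.one_ne_top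
  have hform := hB N Ψ.ψ Ψ.contDiff.continuous.measurable hΨ2
    (ε * sideLength ρ N) (sideLength ρ N - ε * sideLength ρ N) C (Real.sqrt ρ) hC0.le
    (Real.sqrt_nonneg ρ) (hΨ Ψ hE) (windowMode ε (sideLength ρ N) k) hmeas hsupp hmean
    (ne_top_of_le_ne_top ENNReal.one_ne_top hL2)
  exact assembly_arith hC0.le hCR.le (Real.sqrt_nonneg ρ) hL (norm_nonneg _) hL2 hRz hform

/-- Wiring check (an `example`, so that `BecIrWindow_of` stays the only theorem concluding the
crux): the registered stubs feed the skeleton theorem as stated — this term becomes the crux proof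
when the three `sorry`s above are discharged. -/
example : Summit.AtomisticToContinuum.BoseEinsteinCondensation.Theses.BECInfraredBound.BecIrWindow :=
  BecIrWindow_of stub_formInfraredBound stub_formBoundExtension stub_windowModeRiesz

/-- The plain-arrow form `<stub sigs> → BecIrWindow` of the skeleton theorem (same proof term). -/
example : FormInfraredBound → FormBoundExtension → WindowModeRiesz →
    Summit.AtomisticToContinuum.BoseEinsteinCondensation.Theses.BECInfraredBound.BecIrWindow :=
  BecIrWindow_of

end Summit.AtomisticToContinuum.BoseEinsteinCondensation.Cruxes.BecIrWindow.Birth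

end
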